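import Literature.AlgebraicGeometry.HilbertScheme.ChernCharacterOperators
import HarnessLib

/-!
# The divisor class `D_α = G₀(α, n)` is the Nakajima monomial `(1/(n−1)!) 𝔮₁(α) 𝔮₁(1_S)^{n−1} |0⟩` (proved)

Layer `Literature/AlgebraicGeometry/HilbertScheme`; theorems only, no definition, no named fact.  In the
interface `ChernCharacterOperators` (Nakajima's operators `𝔮ₘ` together with the Chern character classes
`G_k(γ, n)`), the divisor class of a surface class `α ∈ H²(S)` on `S^[n]` is recorded as
`𝔊.divisorClass n α = G₀(α, n) ∈ H²(S^[n])`.  The literature on `H²(S^[n])` and on the generalized Kummer varieties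
writes this class as a Nakajima monomial: Beauville's `j : H²(S) → H²(S^[n])`, Kapfer–Menet's
"`j : a ⟼ (1/(n−1)!) θ*(𝔮₁(a) 𝔮₁(1)^{n−1}|0⟩)`" (Notation 5.13), Lehn's divisor of `𝔮₁(α)𝔮₁(1)^{n−1}|0⟩`.  This file
PROVES the identity inside the interface, for EVERY instance `𝔊`, from the axioms `[𝔊₀(γ), 𝔮ₘ(β)] = m 𝔮ₘ(γβ)`
(Li–Qin–Wang Thm. 5.13 (iv) / Lehn), `G(γ, 0) = 0`, the Heisenberg relation `[𝔮₁(α), 𝔮₁(1)] = 0` and the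
normalisation `𝔮₁(1_S)ⁿ|0⟩ = n! · 1_{S^[n]}`:

* `ChernCharacterOperators.cupOperator_zero_commutator_q_one_unit` — `[𝔊₀(α), 𝔮₁(1_S)] = 𝔮₁(α)`;
* `ChernCharacterOperators.cupOperator_zero_unitVector` — `𝔊₀(α) 1_{S^[n]} = D_α` (as vectors of `ℍ`);
* `ChernCharacterOperators.factorial_smul_of_divisorClass` —
  `(k+1)! · D_α = (k+1) · 𝔮₁(α) 𝔮₁(1_S)ᵏ |0⟩` on `S^[k+1]`;
* `ChernCharacterOperators.of_divisorClass_succ` — **`D_α = (1/k!) · 𝔮₁(α) 𝔮₁(1_S)ᵏ |0⟩` on `S^[k+1]`**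
  (Kapfer–Menet's formula with `n = k + 1`).

The computation is the printed one: `n! · D_α = 𝔊₀(α) 𝔮₁(1)ⁿ|0⟩ = Σᵢ 𝔮₁(1)ⁱ [𝔊₀(α), 𝔮₁(1)] 𝔮₁(1)^{n−1−i}|0⟩ =
n · 𝔮₁(α) 𝔮₁(1)^{n−1}|0⟩` (`𝔊₀(α)|0⟩ = 0`, and `𝔮₁(α)` commutes with `𝔮₁(1)`).

## Sources

* S. Kapfer, G. Menet, Integral cohomology of the generalized Kummer fourfold, Algebr. Geom. 5 (2018)
  (arXiv:1607.03431), Notation 5.13 p. 14: "`j : a ⟼ (1/(n−1)!) θ*(𝔮₁(a)𝔮₁(1)^{n−1}|0⟩)`". [KapferMenet2018]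
* W.-P. Li, Z. Qin, W. Wang, Math. Ann. 324 (2002), Thm. 5.13 (iv), (5.6) p. 12–13. [LiQinWang2002]
* M. Lehn, Invent. Math. 136 (1999), Thm. 3.10 / §4 (the classes `𝔮₁(α)𝔮₁(1)^{n−1}|0⟩`). [Lehn1999]
-/

noncomputable section

open DirectSum
open Literature.AlgebraicTopology.SingularHomology
open Literature.AlgebraicGeometry.Motives (SchemeOver ComplexPoints IsSmoothProjective)
open Literature.AlgebraicGeometry.Hyperkaehler (totalCohomology ofDegree totalCup)
open Literature.AlgebraicGeometry.HodgeTheory (complexBetti)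

namespace Literature.AlgebraicGeometry.HilbertScheme

/-! ### Two pieces of plumbing -/

/-- `x ∪ 1 = x` on the total cohomology `H*(Y) = ⨁ₖ Hᵏ(Y)`. [cite: HatcherAT2002, §3.2 p. 211] -/
theorem totalCup_ofDegree_zero_one {Y : Type} [TopologicalSpace Y] (x : totalCohomology ℂ Y) :
    totalCup ℂ Y x (ofDegree ℂ Y 0 (singularCohomology.one ℂ Y)) = x := by
  induction x using DirectSum.induction_on with
  | zero => rw [map_zero, LinearMap.zero_apply]
  | of p a =>
    rw [← lof_eq_of ℂ]
    change totalCup ℂ Y (ofDegree ℂ Y p a) _ = ofDegree ℂ Y p a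
    rw [Hyperkaehler.totalCup_lof]
    exact congrArg (ofDegree ℂ Y p) (cupProduct_one a)
  | add x y hx hy => rw [map_add, LinearMap.add_apply, hx, hy]

/-- Commutator expansion in a ring: if `D Q = Q D + P` and `P Q = Q P` then
`D Q^{n+1} = Q^{n+1} D + (n+1) · Qⁿ P`. [folklore] -/
private theorem mul_pow_succ_of_commutator {R : Type*} [Ring R] {D Q P : R} (hDQ : D * Q = Q * D + P)
    (hPQ : P * Q = Q * P) : ∀ n : ℕ, D * Q ^ (n + 1) = Q ^ (n + 1) * D + (n + 1) • (Q ^ n * P)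
  | 0 => by rw [zero_add, pow_one, pow_zero, one_mul, one_smul, hDQ]
  | n + 1 => by
    rw [pow_succ Q (n + 1), ← mul_assoc, mul_pow_succ_of_commutator hDQ hPQ n, add_mul, smul_mul_assoc,
      mul_assoc (Q ^ (n + 1)) D Q, hDQ, mul_add, mul_assoc (Q ^ n) P Q, hPQ, ← mul_assoc (Q ^ n) Q P, ← pow_succ,
      ← mul_assoc, add_assoc, ← succ_nsmul' (Q ^ (n + 1) * P) (n + 1)]

variable {S : SchemeOver ℂ} {hS : IsSmoothProjective 2 S} {H : HilbertSchemesOfPoints S}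

namespace ChernCharacterOperators

/-! ### `[𝔊₀(α), 𝔮₁(1)] = 𝔮₁(α)` and `[𝔮₁(α), 𝔮₁(1)] = 0` -/

/-- **`[𝔊₀(α), 𝔮₁(1_S)] = 𝔮₁(α)`** for `α ∈ H²(S)` (the case `γ = α`, `m = 1`, `β = 1_S` of the axiom
`[𝔊₀(γ), 𝔮ₘ(β)] = m 𝔮ₘ(γβ)`). [cite: LiQinWang2002, Thm. 5.13 (iv) p. 13] -/
theorem cupOperator_zero_commutator_q_one_unit (𝔊 : ChernCharacterOperators hS H) (α : complexBetti S 2) :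
    𝔊.cupOperator 0 (ofDegree ℂ (ComplexPoints S) 2 α) * 𝔊.q 1 (unitCoeff S) -
        𝔊.q 1 (unitCoeff S) * 𝔊.cupOperator 0 (ofDegree ℂ (ComplexPoints S) 2 α) =
      𝔊.q 1 (ofDegree ℂ (ComplexPoints S) 2 α) := by
  have h := 𝔊.G_zero_bracket 2 α 1 0 (singularCohomology.one ℂ (ComplexPoints S))
  rw [superBracket, show ((-1 : ℂ) ^ (2 * 0)) = 1 by norm_num, one_smul, Int.cast_one, one_smul,
    totalCup_ofDegree_zero_one] at h
  exact h

/-- **`𝔮₁(α)` commutes with `𝔮₁(1_S)`** (the Heisenberg relation with `m + l = 2 ≠ 0`, both classes even).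
[cite: LiQinWang2002, Thm. 2.16 (i) p. 5] -/
theorem q_one_mul_q_one_unit_comm (𝔊 : ChernCharacterOperators hS H) (α : complexBetti S 2) :
    𝔊.q 1 (ofDegree ℂ (ComplexPoints S) 2 α) * 𝔊.q 1 (unitCoeff S) =
      𝔊.q 1 (unitCoeff S) * 𝔊.q 1 (ofDegree ℂ (ComplexPoints S) 2 α) := by
  have h := 𝔊.isHeisenberg.bracket 1 1 2 0 α (singularCohomology.one ℂ (ComplexPoints S))
  rw [show ((-1 : ℂ) ^ (2 * 0)) = 1 by norm_num, one_smul, if_neg (by norm_num)] at h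
  exact sub_eq_zero.mp h

/-! ### `𝔊₀(α) 1_{S^[n]} = D_α` and the Nakajima monomial -/

/-- **`𝔊₀(α) · 1_{S^[n]} = D_α`**: the operator `𝔊₀(α)` (cup product with `G₀(α, n)` on `H*(S^[n])`) sends the unit
class of `S^[n]` to the divisor class `D_α ∈ H²(S^[n])`, both read in `ℍ`. [cite: LiQinWang2002, Def. 5.1 p. 12] -/
theorem cupOperator_zero_unitVector (𝔊 : ChernCharacterOperators hS H) (n : ℕ) (α : complexBetti S 2) :
    𝔊.cupOperator 0 (ofDegree ℂ (ComplexPoints S) 2 α) (unitVector H n) =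
      Fock.of ℂ (fockFamily H) n 2 (𝔊.divisorClass n α) := by
  rw [unitVector, Fock.of, LinearMap.comp_apply]
  erw [𝔊.cupOperator_apply_ofSummand 0 _ n]
  rw [Fock.of, LinearMap.comp_apply]
  refine congrArg (Fock.ofSummand ℂ (fockFamily H) n) ?_
  change totalCup ℂ (ComplexPoints (H.obj n)) _ (ofDegree ℂ (ComplexPoints (H.obj n)) 0 _) =
    ofDegree ℂ (ComplexPoints (H.obj n)) 2 (𝔊.divisorClass n α)
  rw [totalCup_ofDegree_zero_one, 𝔊.ofDegree_divisorClass]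

/-- **`(k+1)! · D_α = (k+1) · 𝔮₁(α) 𝔮₁(1_S)ᵏ |0⟩` in `ℍ`** (`D_α` the divisor class on `S^[k+1]`): apply `𝔊₀(α)` to
`𝔮₁(1)^{k+1}|0⟩ = (k+1)! · 1_{S^[k+1]}` and expand the commutator. [cite: KapferMenet2018, Notation 5.13 p. 14]
[cite: LiQinWang2002, Thm. 5.13 (iv) and (5.6)] -/
theorem factorial_smul_of_divisorClass (𝔊 : ChernCharacterOperators hS H) (k : ℕ) (α : complexBetti S 2) :
    ((k + 1).factorial : ℂ) • Fock.of ℂ (fockFamily H) (k + 1) 2 (𝔊.divisorClass (k + 1) α) =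
      (k + 1) • 𝔊.q 1 (ofDegree ℂ (ComplexPoints S) 2 α) ((𝔊.q 1 (unitCoeff S) ^ k) (vacuumVector H)) := by
  have hDQ : 𝔊.cupOperator 0 (ofDegree ℂ (ComplexPoints S) 2 α) * 𝔊.q 1 (unitCoeff S) =
      𝔊.q 1 (unitCoeff S) * 𝔊.cupOperator 0 (ofDegree ℂ (ComplexPoints S) 2 α) +
        𝔊.q 1 (ofDegree ℂ (ComplexPoints S) 2 α) := by
    rw [← 𝔊.cupOperator_zero_commutator_q_one_unit α]
    abel
  have hPQ : Commute (𝔊.q 1 (ofDegree ℂ (ComplexPoints S) 2 α)) (𝔊.q 1 (unitCoeff S)) :=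
    𝔊.q_one_mul_q_one_unit_comm α
  have key := mul_pow_succ_of_commutator (R := Module.End ℂ (fockSpace H)) hDQ hPQ.eq k
  -- `(k+1)! • D_α = 𝔊₀(α) (𝔮₁(1)^{k+1} |0⟩) = (𝔮₁(1)^{k+1} 𝔊₀(α) + (k+1) • 𝔮₁(1)^k 𝔮₁(α)) |0⟩`
  rw [← 𝔊.cupOperator_zero_unitVector (k + 1) α, ← map_smul, ← 𝔊.unit_pow (k + 1), ← Module.End.mul_apply, key,
    LinearMap.add_apply, Module.End.mul_apply, 𝔊.cupOperator_vacuum, map_zero, zero_add, LinearMap.smul_apply,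
    ← (hPQ.pow_right k).eq, Module.End.mul_apply]

/-- **`D_α = (1/k!) · 𝔮₁(α) 𝔮₁(1_S)ᵏ |0⟩` on `S^[k+1]`** — Kapfer–Menet's "`j : a ⟼ (1/(n−1)!) 𝔮₁(a)𝔮₁(1)^{n−1}|0⟩`"
(before restriction to the Kummer variety), with `n = k + 1`, for the divisor class `D_α = G₀(α, n)` of EVERY
instance of the interface. [cite: KapferMenet2018, Notation 5.13 p. 14] [cite: Lehn1999, Thm. 3.10] -/
theorem of_divisorClass_succ (𝔊 : ChernCharacterOperators hS H) (k : ℕ) (α : complexBetti S 2) :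
    Fock.of ℂ (fockFamily H) (k + 1) 2 (𝔊.divisorClass (k + 1) α) =
      ((k.factorial : ℂ))⁻¹ • 𝔊.q 1 (ofDegree ℂ (ComplexPoints S) 2 α) ((𝔊.q 1 (unitCoeff S) ^ k) (vacuumVector H)) := by
  have h := 𝔊.factorial_smul_of_divisorClass k α
  have hk : ((k.factorial : ℂ)) ≠ 0 := by exact_mod_cast k.factorial_ne_zero
  have hk1 : ((k + 1 : ℕ) : ℂ) ≠ 0 := by exact_mod_cast Nat.succ_ne_zero k
  rw [Nat.factorial_succ, Nat.cast_mul, mul_smul, ← Nat.cast_smul_eq_nsmul ℂ (k + 1)] at h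
  have h' := smul_right_injective _ hk1 h
  rw [← h', smul_smul, inv_mul_cancel₀ hk, one_smul]

/-- The same for the divisor class on `S^[1] = S`: `D_α = 𝔮₁(α)|0⟩` in `ℍ`. [cite: KapferMenet2018, Notation 5.13 p. 14] -/
theorem of_divisorClass_one (𝔊 : ChernCharacterOperators hS H) (α : complexBetti S 2) :
    Fock.of ℂ (fockFamily H) 1 2 (𝔊.divisorClass 1 α) = 𝔊.q 1 (ofDegree ℂ (ComplexPoints S) 2 α) (vacuumVector H) := by
  rw [𝔊.of_divisorClass_succ 0 α, Nat.factorial_zero, Nat.cast_one, inv_one, one_smul, pow_zero, Module.End.one_apply]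

end ChernCharacterOperators

end Literature.AlgebraicGeometry.HilbertScheme

end
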